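import Summits.ValiantsHypothesis.ValiantsHypothesis.Theorems.BarrierLeverAnchoredDoorHitsLowerPairsEvalGP

/-!
# Route BarrierLever — support item `AnchoredDoorHitsLowerPairs` (stmt-ValiantsHypothesis-22510), line `anchored_peeling`:
# THE STAR-FOREST MATRIX — conjecture nodes TN-STAR and STAR-LOWER (offered texts, val-np-p1 g30)

THE OBJECT. For finite vertex sets of rows `X` and columns `Y` (here both `Fin h`) and edge weights `g d : Fin h → Fin h → K`, the STAR-FOREST MATRIX
has rows and columns indexed by finite sets of vertices and entries

  `starEntry g d A S = Σ_{A' ⊆ A} Σ_{S' ⊆ S} (∏_{b ∈ A ∖ A'} Σ_{e ∈ S'} g b e) · (∏_{e ∈ S ∖ S'} Σ_{b ∈ A'} d b e)`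

— the sum over all STAR FORESTS on the vertex set `A ⊔ S` of the complete bipartite graph (every vertex is either a CENTER or a LEAF hanging from a
center on the other side; `A'` = the row centers, `S'` = the column centers; isolated centers allowed) of the product of the weights of the leaf edges
(`g b e` for a row leaf `b` hanging from the column center `e`, `d b e` for a column leaf `e` hanging from the row center `b`). It is the coefficient
matrix of the zeon product `∏_b (1 + x_b ∏_e (1 + d_{be} y_e)) · ∏_e (1 + y_e ∏_b (1 + g_{be} x_b))`, i.e. (up to the unitriangular zeta factors on
lower families, which do not change determinants of lower × lower blocks) the layout matrix of the PRODUCT of the evaluation door `E(g)` of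
`…EvalDoor` (root weights `θ_{be} = g_{be}`, ordered `x`-tails) with its transpose analogue `Eᵀ(d)`. That product is a member of the PROFILE-2 anchored door
𝔄₂: vertex anchors `({a},{d})` of weight `g_{ad} + d_{ad}` (no tails), anchors `({a,b},{d})` (`a < b`) of weight `g_{ad} g_{bd}` with `x`-tails
`[b' > b] g_{b'd}`, anchors `({a},{d,e})` (`d < e`) of weight `d_{ad} d_{ae}` with `y`-tails `[e' > e] d_{ae'}`, anchors `({a,b},{d,e})` of weight `0`
(each vertex factor of `E` rewrites as `(1 + θ x_a y_d) ∏_{b>a} (1 + θ_{ad} θ_{bd} x_a x_b y_d ∏_{b'>b} (1 + θ_{b'd} x_{b'}))` because all summands share the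
nilpotent `x_a y_d`; verified on every squarefree coefficient for `|X|+|Y| ≤ 7`, HOME/val-np-p1/g30/lab/a2check.py).

THE CONJECTURES (memo HOME/val-np-p1/g30/MEMO-char2-valnp1-g30.md §4, evidence on 22510).
* `Stmt.conjStarLower` (= «PEE», generic form): for every pair of injective LOWER families `u`, `w` of the same size some complex `g, d` make the
  `r × r` block `(starEntry g d (u i) (w j))` nonsingular. CENSUS at the Frobenius point `g_{be} = γ_e^{2^b}`, `d_{be} = δ_b^{2^e}` MOD 2 (where the
  entry collapses to `Σ σ_{S'}^{bin(A∖A')} τ_{A'}^{bin(S∖S')}`, `σ`/`τ` subset-sum linear forms): nonsingular on ALL 1 160 lower pairs on `≤ 5+5` vertices,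
  all 189 on `4+5`, every named pair of the line with `r ≤ 384` and 550 random lower pairs `r ≤ 128` — zero failures, default labelling, no orientation
  or vertex choice (lab/pee.py, lab/peenamed.py; kit j332343/j332344). Via the 𝔄₂ membership above, `conjStarLower` gives `symbolicDet 2 ≠ 0` on every
  lower pair, hence the item with `s = 2` — that ARROW is the open kernel task (it needs the profile-2 layout identity for the stated parameter point).
* `Stmt.conjStarTN` (stronger): the full `2^h × 2^h` star-forest matrix is TOTALLY NONSINGULAR — for ALL injective row and column families of equal size
  (no lower-set hypothesis) some `g, d` make the block nonsingular (equivalently: every square minor is a nonzero polynomial in the `g, d`). CENSUS: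
  all 12 869 minors for `|X| = |Y| = 3` (three parametrisations incl. GF(p)), 4 500 random minors of all sizes for `4+4`, and `3+5`, `2+6`, `5+5`
  (sizes to 32): zero singular (lab/tn_exhaust.py, lab/pigen.py; kit j332436). It is the permanent-free profile-2 sibling of `Stmt.conjUDoorTNS`
  (p718322): the U-door's blocks are DOUBLE stars tied by an anchor with a permanent weight and `|A| = |D|`; here the stars are independent and `∅` is an
  ordinary index. STRUCTURE for a proof: `starEntry = Σ_{(A',S')} (∂^{A'} x^{A})(p_{S'}) · (∂^{S'} y^{S})(q_{A'})` over Hasse–Hermite functionals at the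
  subset-sum points `p_S = Σ_{e∈S} g_{·e}`, `q_A = Σ_{b∈A} d_{b·}` (a Cauchy–Binet whose classes are graded by vertex-degree statistics; the extreme classes
  are generalised Vandermondes and can vanish, the surviving classes are interior); over `ℤ` the minors carry coefficients `±2, ±4` but always some `±1`.

WHAT THIS FILE IS: the two node texts (definitions only) and the trivial implication `conjStarTN → conjStarLower`. WHAT IT IS NOT: no arrow to the
item yet (see above); nothing on crux 14610 or `VP ≠ VNP`. Refuter target of record: ONE square minor of the star-forest matrix that vanishes for all `g, d`.
-/

set_option linter.dupNamespace false

namespace Summit.ValiantsHypothesis.ValiantsHypothesis.Theorems.BarrierLever.AnchoredPeeling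

open Finset

noncomputable section

namespace StarDoor

variable {K : Type*} [CommRing K] {h : ℕ}

/-- **The star-forest entry.** `starEntry g d A S = Σ_{A' ⊆ A, S' ⊆ S} (∏_{b ∈ A ∖ A'} Σ_{e ∈ S'} g b e) · (∏_{e ∈ S ∖ S'} Σ_{b ∈ A'} d b e)`:
the sum over star forests on `A ⊔ S` (`A'` = row centers, `S'` = column centers; every other vertex is a leaf hanging from a center on the other
side) of the product of the leaf-edge weights. -/
def starEntry (g d : Fin h → Fin h → K) (A S : Finset (Fin h)) : K :=
  ∑ A' ∈ A.powerset, ∑ S' ∈ S.powerset, (∏ b ∈ A \ A', ∑ e ∈ S', g b e) * (∏ e ∈ S \ S', ∑ b ∈ A', d b e)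

/-- The empty row against the empty column: the empty forest, entry `1`. -/
theorem starEntry_empty_empty (g d : Fin h → Fin h → K) : starEntry g d ∅ ∅ = 1 := by
  simp [starEntry]

end StarDoor

/-- **CONJECTURE STAR-LOWER («PEE», offered node text, val-np-p1 g30).** For all `h`, `r` and every pair of injective enumerations `u`, `w` of LOWER
families of faces with the same number of faces, some complex edge weights `g d` make the star-forest block `(starEntry g d (u i) (w j))_{i j}` nonsingular.
WHY IT MIGHT FAIL: one lower pair on which every `r × r` star-forest block is singular for all weights (none among all pairs on `≤ 5+5` vertices, the named
pairs `r ≤ 384`, 550 random pairs). CONSEQUENCE (arrow not yet in the kernel): the product door `E(g)·Eᵀ(d) ∈ 𝔄₂` then has nonzero partition minor on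
the pair, so `symbolicDet 2 h r u w ≠ 0` and the item holds with `s = 2`. -/
def Stmt.conjStarLower : Prop :=
  ∀ (h r : ℕ) (u w : Fin r → Finset (Fin h)), Function.Injective u → Function.Injective w →
    IsLowerSet (Set.range u) → IsLowerSet (Set.range w) →
    ∃ g d : Fin h → Fin h → ℂ, (Matrix.of fun i j : Fin r => StarDoor.starEntry g d (u i) (w j)).det ≠ 0

/-- **CONJECTURE TN-STAR (offered node text, val-np-p1 g30): the star-forest matrix is totally nonsingular.** For all `h`, `r` and EVERY pair of
injective families `u`, `w` of `r` faces each (no lower-set hypothesis), some complex `g d` make `(starEntry g d (u i) (w j))_{i j}` nonsingular —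
equivalently every square minor of the `2^h × 2^h` star-forest matrix is a nonzero polynomial in the `2h²` edge weights. WHY IT MIGHT FAIL: a single
identically vanishing minor (none among all 12 869 minors at `3+3`, thousands of random minors of every size up to `5+5`, generic and Frobenius weights,
characteristic 2 and p). -/
def Stmt.conjStarTN : Prop :=
  ∀ (h r : ℕ) (u w : Fin r → Finset (Fin h)), Function.Injective u → Function.Injective w →
    ∃ g d : Fin h → Fin h → ℂ, (Matrix.of fun i j : Fin r => StarDoor.starEntry g d (u i) (w j)).det ≠ 0

/-- TN-STAR ⟹ STAR-LOWER (drop the lower-set hypotheses). -/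
theorem conjStarLower_of_conjStarTN (hT : Stmt.conjStarTN) : Stmt.conjStarLower :=
  fun h r u w hu hw _ _ => hT h r u w hu hw

end

end Summit.ValiantsHypothesis.ValiantsHypothesis.Theorems.BarrierLever.AnchoredPeeling
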